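import Mathlib
import HarnessLib
import Summits.HubbardSuperconductivity.HubbardSuperconductivity.Theorems.KLProgrammeKLRegimeSplitTwoLegAngularOfMoments
import Summits.HubbardSuperconductivity.HubbardSuperconductivity.Theorems.KLProgrammeKLRegimeSplitTwoLegMomentsFromPosition

/-!
# Route `KLProgramme` — gen-5 ENGINE child, two-leg stubs: (E3g) `TwoLegAngularG` END TO END from the scale-`n` position-space two-leg kernel
# moments (p1b g5's `twoLegAngularG_of_moments` ∘ p1b g6's Fourier bridge)

Cell `gate-hubbard-kl`, seat p1b (g6).  (E3g) `TwoLegAngularG … K n` (kept verbatim in the gen-5 slot, plan g12 (R3); `angBar` frozen and certified,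
k3c3-p3 g3 02:01Z) follows from the coefficient moments of the two-leg data + the curve's `C⁴` bounds + the fit (`…TwoLegAngularOfMoments`, p473408);
the coefficient moments follow from the pinned spatial moments of the unsectorised position two-leg kernel (`…TwoLegMomentsFromPosition`, p485541).
Composed: `twoLegAngularG_of_position_moments_and_curve` (frame-hypothesis-free: curve data as hypotheses) and `twoLegAngularG_of_position_moments`
(keyed by `FrameOK` in the KL regime).  Proofs only; nothing about the model is asserted.  References: BGM 2006 (2.36) [cite: BenfattoGiulianiMastropietro2006].
-/

noncomputable section

namespace Summit.HubbardSuperconductivity.HubbardSuperconductivity.Theorems.KLRegimeSplit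

set_option linter.dupNamespace false -- summit = problem name (single-conjunct summit), D-0017

open Real Finset
open Literature.MathematicalPhysics.QuantumLattice Literature.Probability.LatticeModels
open Summit.HubbardSuperconductivity.HubbardSuperconductivity.Theorems.KLProgrammeLegKernels
open Summit.HubbardSuperconductivity.HubbardSuperconductivity.Theorems.PerturbedFermiCurve
open Summit.HubbardSuperconductivity.HubbardSuperconductivity.Theorems.TwoLegFourier

section Model

variable {L M : ℕ} [NeZero L] [NeZero M]

/-- **(E3g) FROM POSITION-SPACE MOMENTS AND THE CURVE**: `β > 0`; the scale-`n` unsectorised position two-leg kernels `W_σ^{(n)}` with pinned spatial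
moments of every order `k ≤ 4` bounded by `Mˢ` (both spins); the Fermi-point map `C⁴` with `‖γ⁽ⁱ⁾‖ ≤ Dⁱ`; and the fit `j!·(2Mˢ)·Dʲ ≤ angBar … j`
(`1 ≤ j ≤ 4`).  Then `TwoLegAngularG L M G Q R β U μ K n`. -/
theorem twoLegAngularG_of_position_moments_and_curve {G : GeoConsts} {Q : EngConsts} {R : RenConsts} {β U μ : ℝ} (hβ : 0 < β)
    {K : TrigPolyC4v} {n : ℕ} {Ms D : ℝ}
    (hMs : ∀ k ≤ 4, ∀ (σ : Fin 2) (x₀ : SpaceTimeIdx L M), imagTimeWeight β M *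
      ∑ x ∈ (univ : Finset (Fin 2 → SpaceTimeIdx L M)).filter (fun x => x 0 = x₀),
        (1 + ((((x 1).2 - (x 0).2) 0).valMinAbs.natAbs : ℝ) + ((((x 1).2 - (x 0).2) 1).valMinAbs.natAbs : ℝ)) ^ k *
          ‖sectorisedKernel L M β (trivialMultiplier L M) (klEffectiveAction L M β U μ K klE0 n) 2
            (![((0, σ), 0), ((0, σ), 1)] : Fin 2 → SectorLeg 1) x‖ ≤ Ms)
    (hγ : ContDiff ℝ 4 fun θ => (WithLp.toLp 2 (klFermiPoint μ K θ) : Momentum))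
    (hD : ∀ i, 1 ≤ i → i ≤ 4 → ∀ θ : ℝ, ‖iteratedDeriv i (fun θ => (WithLp.toLp 2 (klFermiPoint μ K θ) : Momentum)) θ‖ ≤ D ^ i)
    (hfit : ∀ j, 1 ≤ j → j ≤ 4 → (j.factorial : ℝ) * (2 * Ms) * D ^ j ≤ angBar G Q R U (nScales β) j) :
    TwoLegAngularG L M G Q R β U μ K n :=
  twoLegAngularG_of_moments_and_curve (fun j hj => sum_weight_abs_torusCosCoeff_klLocSelfEnergyRe_le hβ U μ K n j (hMs j hj)) hγ hD hfit

/-- **(E3g) FOR EVERY ADMISSIBLE FRAME IN THE KL REGIME, FROM POSITION-SPACE MOMENTS ALONE**: for every `R` (`Gfr ≥ 0`) there are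
`c₃, U₀ > 0` and, in the regime, a curve constant `D ≥ 1` such that for `μ ∈ klWindowC`, every admissible `K`, all volumes / packages / scales:
pinned spatial moments of orders `≤ 4` of `W^{(n)}` bounded by `Mˢ` + the fit `j!·(2Mˢ)·Dʲ ≤ angBar … j` ⇒ `TwoLegAngularG … K n`. -/
theorem twoLegAngularG_of_position_moments (R : RenConsts) (hR : ∀ j, 0 ≤ R.Gfr j) :
    ∃ c₃ : ℝ, 0 < c₃ ∧ ∃ U₀ : ℝ, 0 < U₀ ∧
      ∀ c : ℝ, 0 < c → c ≤ c₃ → ∀ U : ℝ, 0 < U → U ≤ U₀ → ∀ β : ℝ, klBetaMin ≤ β → β ≤ Real.exp (c / U ^ 2) →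
      ∃ D : ℝ, 1 ≤ D ∧ ∀ μ ∈ klWindowC, ∀ K : TrigPolyC4v, FrameOK R U (nScales β) μ K →
        ∀ (L M : ℕ) [NeZero L] [NeZero M] (G : GeoConsts) (Q : EngConsts) (n : ℕ) (Ms : ℝ),
          (∀ k ≤ 4, ∀ (σ : Fin 2) (x₀ : SpaceTimeIdx L M), imagTimeWeight β M *
            ∑ x ∈ (univ : Finset (Fin 2 → SpaceTimeIdx L M)).filter (fun x => x 0 = x₀),
              (1 + ((((x 1).2 - (x 0).2) 0).valMinAbs.natAbs : ℝ) + ((((x 1).2 - (x 0).2) 1).valMinAbs.natAbs : ℝ)) ^ k *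
                ‖sectorisedKernel L M β (trivialMultiplier L M) (klEffectiveAction L M β U μ K klE0 n) 2
                  (![((0, σ), 0), ((0, σ), 1)] : Fin 2 → SectorLeg 1) x‖ ≤ Ms) →
          (∀ j, 1 ≤ j → j ≤ 4 → (j.factorial : ℝ) * (2 * Ms) * D ^ j ≤ angBar G Q R U (nScales β) j) →
          TwoLegAngularG L M G Q R β U μ K n := by
  obtain ⟨c₃, hc₃, U₀, hU₀, h⟩ := twoLegAngularG_of_moments R hR
  refine ⟨c₃, hc₃, U₀, hU₀, fun c hc hcle U hU hUle β hβmin hβc => ?_⟩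
  obtain ⟨D, hD1, hD⟩ := h c hc hcle U hU hUle β hβmin hβc
  refine ⟨D, hD1, fun μ hμ K hK L M _ _ G Q n Ms hMs hfit => ?_⟩
  have hβ : 0 < β := lt_of_lt_of_le (by unfold klBetaMin; norm_num) hβmin
  exact hD μ hμ K hK L M G Q n (2 * Ms) (fun j hj => sum_weight_abs_torusCosCoeff_klLocSelfEnergyRe_le hβ U μ K n j (hMs j hj)) hfit

end Model

end Summit.HubbardSuperconductivity.HubbardSuperconductivity.Theorems.KLRegimeSplit

end
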